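import Literature.MathematicalPhysics.QuantumFieldTheory.Balaban1983to89.B9Eq342SupNormBootstrap
import Literature.MathematicalPhysics.QuantumFieldTheory.Balaban1983to89.B9Eq342CoshWeightSite
import Literature.MathematicalPhysics.QuantumFieldTheory.Balaban1983to89.B5Eq129FreeResolventWeightedAdjointRow

/-!
# `Balaban1983to89.B9Eq342CovariantResolventAdjointRowLetters` — T. Bałaban, *Propagators for lattice gauge theories in a background field*, Commun. Math. Phys.
# **99** (1985) 389–434 [Balaban1985BackgroundPropagators] Thm 3.1 (3.42) p. 397, THIRD ENTRY `|(G′(U)∇*_Uλ)(x)| ≤ B₀L^jηe^{−δ₀d(y,y′)}|λ|`, with (3.23) p. 394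
# (`Δ^η_U = D*_UD_U`), (3.3) p. 391, (3.8) p. 392: **THE LETTERS OF THE PERTURBATIVE ROAD TO THE ADJOINT (DIVERGENCE) ROW OF THE COVARIANT MASSIVE RESOLVENT
# `(Δ^η_U + m)⁻¹D*_U` AROUND `U = 1`** — for ABSTRACT transporter data `R(b)`, `S(b)` on the fibre (`S(b)R(b) = 1`, contractions, `‖R(b)w − w‖, ‖S(b)w − w‖ ≤ ε‖w‖`,
# `‖S(x,μ)w − S(x−e_μ,μ)w‖ ≤ ε′‖w‖`): (i) positivity of `Δ_{RS} + m`; (ii) the `cosh`-WEIGHTED covariant VALUE row (Kato domination by the weight supersolution);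
# (iii) the flat weighted ADJOINT row read in the chain's `SiteL2K` currency; (iv) THE DIVERGENCE-FORM SPLIT `(Δ_{RS} − Δ_1)z = D*_S q + s` with
# `‖q(b)‖ ≤ tε(‖z(b₊)‖ + ‖z(b₋)‖)`, `‖s(x)‖ ≤ t²Σ_μ(ε²‖z(x−e_μ)‖ + ε′‖z(x)‖)`, and `D*_Sf = D*_1f + Bf` with `‖(Bf)(x)‖ ≤ tεΣ_μ‖f(x−e_μ,μ)‖` — the cancellation that
# makes the first-order perturbation `Δ_U − Δ_1` BOUNDED on the model (`tε = η⁻¹·O(αη)`, `t²ε′ = η⁻²·O(αη²)`)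

statement-level skeleton of published theorems with citation tags; proofs where landed; nothing here is a claim about the Yang–Mills mass gap

CITATION HEADER (lean-in-tree rule).  Audit cell `pub-balaban`, sub-cell `t4`, BINDER row NE9; filed by NE9 crux-team LEAF PROVER 01 (`b2b-balaban-t4-ne9-formalise-leaf-01`,
gen 93; bears_on: R4/N22).  Source READ first-hand (`paper:balaban1985-cmp99-background-propagators`, journal page = PDF page + 388): p. 391 (3.3), p. 392 (3.8), p. 394
(3.23), p. 396 (3.35) *«|U(Γ_{y,x}) − 1| ≤ α₀L^jη…»* (the small-field class; the cell's MODEL: `‖U(b) − 1‖ ≤ αη`, `‖U(x,μ) − U(x−e_μ,μ)‖ ≤ αη²`), p. 397 Thm 3.1 (3.42)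
third member; p. 398 *«We will prove the above theorem by constructing a random walk representation»* — NOT reproduced: the cell's road to this member is the
perturbation of the covariant massive resolvent around the flat one (this file's letters + `B9Eq342CovariantResolventAdjointRow`), Kato domination
(`B9Eq323KatoDomination`, [DodziukMathai2006] §1 by name) and the flat free-resolvent rows of NE9 leaf-05 (`B5Eq129FreeResolventWeightedGradientRowOperator`) ∕ this
lineage (`B5Eq129FreeResolventWeightedAdjointRow`).  Nothing printed is a hypothesis; the `[cite: …]` tags are TEXT LOCATIONS.

WHAT IS PROVED (sorry-free; proof lane — 0 `def`; [folklore] lattice calculus).  Data: the chain's periodic lattice `TSite d P` (`P_ν ≥ 2` where needed), fibre `W`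
(finite-dimensional complex inner-product space), weight `c₀`, real `t` (print: `η⁻¹`), mass `m > 0`, transporters `R S : Bond d P → W →ₗ[ℂ] W`, the product-`cosh`
weight `W_{x₀}(y) = Π_μ cosh(a·d_μ(x₀,y))` of `B9Eq342CoshWeightSite` centred at a site `x₀`.
* §1 **`rePos_covLaplaceSiteK_add`** — `0 < re⟨f, (Δ_{RS} + m)f⟩` for `f ≠ 0` (mutually adjoint `R`, `S`; `D*_S = D_R†`).
* §2 **`norm_apply_le_weighted_of_resolvent`** — THE WEIGHTED COVARIANT VALUE ROW: `S(b)R(b) = 1`, contractions, `(Δ_{RS} + m)u = g`, `‖g(y)‖ ≤ G_s·W_{x₀}(y)`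
  (`G_s ≥ 0`), window `2d·t²(cosh a − 1) < m` ⟹ `‖u(x)‖ ≤ (m − 2d·t²(cosh a − 1))⁻¹·G_s·W_{x₀}(x)` (domination by the flat scalar resolvent of `G_s·W_{x₀}`, which the
  weight supersolution bounds).
* §3 **`norm_apply_le_weighted_of_flat_resolvent_covDiv`** — THE FLAT WEIGHTED ADJOINT ROW IN THE CHAIN's CURRENCY: `(Δ_1 + m)u = D*_1f` in `SiteL2K ℂ` (`R = S = 1`),
  `‖f(b)‖ ≤ F·W_{x₀}(b₋)` ⟹ `‖u(x)‖ ≤ t·(Σ_νB_ν)·F·W_{x₀}(x)` (`B5Eq129FreeResolventWeightedAdjointRow` §2, real∕complex scalars bridged).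
* §4 THE SPLIT LETTERS (pointwise, written on plain functions; `S(b)R(b) = 1` only): **`covDiv_sub_covDiv_flat_apply`** (`D*_Sf − D*_1f` pointwise) with
  **`norm_covDiv_sub_covDiv_flat_apply_le`**; **`covLaplace_sub_flat_eq_covDiv_add`** — `(Δ_{RS} − Δ_1)z = D*_Sq + s` for the bond field
  `q(x,μ) = t•((R(x,μ) − 1)z(x+e_μ) − (S(x,μ) − 1)z(x))` and the site field `s(x) = t²•Σ_μ((S(x−e_μ,μ) − 1)²z(x−e_μ) + (S(x−e_μ,μ) − S(x,μ))z(x))`, with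
  **`norm_q_apply_le`**, **`norm_s_apply_le`**.
HONEST SCOPE.  Letters only (the bootstrap and the row are `B9Eq342CovariantResolventAdjointRow`); abstract transporters — the instantiation `R = R(U)`, `S = R(U⁻¹)` on the
(T4E) block (`ε = 2M_φM_φ′αη`, `ε′` from `‖U(x,μ) − U(x−e_μ,μ)‖ ≤ αη²`) is the consumer's; the MASSIVE resolvent only (the averaged `G′_k(U)` follows by
`G′_kD*_U = G_mD*_U + G′_k[(m − a′Q̃′†Q̃′)G_mD*_U]` with the OWNER's closed decayed value row — a further file); no ∇-row, no Hölder row.  NOT summit progress (cell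
pub-balaban: NE9 NOT PRINTED ∕ NOT PROVED; «NE9 ⇐ the named binders»; row WALLED ON A MODEL (O-NE9-1; #5 UNRULED); spine PROVED 0∕9; rung (B)+1 finite T⁴ — NOT infinite
volume, NOT mass gap, NOT BetaPertH, NOT Clay).  HONEST DEPENDENCY (cell line): continuum YM on T⁴ ⇐ BetaPertH ∧ nine spine estimates (0/9 proved); BetaPertH ⇐ (D1) ∧ (D4)
∧ CAP+tail; G-an2-4 gates asym, D1 and NE2/3/4.  NEW file; nothing modified.  Net new unproved facts: 0.
-/

noncomputable section

open scoped InnerProductSpace ComplexConjugate BigOperators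

namespace Literature.MathematicalPhysics.QuantumFieldTheory.Balaban1983to89.B9Eq342CovariantResolventAdjointRowLetters

open B4Sect5Torus (TSite)
open B4TorusKernel.MultiPeriod (circAbs)
open B9SectCLatticeCarrier (Bond bpos btgt shift unshift shift_unshift unshift_shift)
open B9Eq311L2Pairing (WL2)
open B9Eq33CovDerivVector (covDeriv covDiv covDeriv_apply_dir covDiv_apply)
open B11Eq103H1Complex (SiteL2K BondL2K covDerivL2K covDivL2K covLaplaceSiteK equiv_covDerivL2K equiv_covDivL2K inner_covDivL2K_covDerivL2K)
open B9Eq323KatoDomination (equiv_covLaplaceSiteK_eq_sum norm_le_scalar_of_covLaplaceSiteK_resolvent exists_scalar_resolvent)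
open B9Eq342SupNormBootstrap (scalar_le_mul_of_supersolution)
open B9Eq342CoshWeightSite (weight_site_supersolution weight_site_pos)
open B5Eq129FreeResolventWeightedAdjointRow (norm_apply_le_of_resolvent_covDiv_weighted)

variable {d : ℕ} {P : Fin d → ℕ} {W : Type*} [NormedAddCommGroup W] [InnerProductSpace ℂ W] {c₀ : ℝ} [Fact (0 < c₀)]

/-! ## §1 Positivity of `Δ_{RS} + m` -/

/-- **`0 < re⟨f, (Δ^η_{RS} + m)f⟩ = ‖D_Rf‖² + m‖f‖²` for `f ≠ 0`**, mutually adjoint transporter data (`⟨R(b)v, u⟩ = ⟨v, S(b)u⟩`, so `D*_S = D_R†`,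
`B11Eq103H1Complex.inner_covDivL2K_covDerivL2K`), real `t`, `m > 0` — the `hpos` letter of `greenK` for the covariant massive resolvent.
[folklore] [cite: Balaban1985BackgroundPropagators, (3.23) p.394, (3.10) p.392] -/
theorem rePos_covLaplaceSiteK_add [FiniteDimensional ℂ W] (t : ℝ) {m : ℝ} (hm : 0 < m) (R S : Bond d P → W →ₗ[ℂ] W)
    (hRS : ∀ (b : Bond d P) (v u : W), ⟪R b v, u⟫_ℂ = ⟪v, S b u⟫_ℂ) (f : SiteL2K ℂ d P c₀ W) (hf : f ≠ 0) :
    0 < RCLike.re ⟪f, ((covLaplaceSiteK (c₀ := c₀) (t : ℂ) R S + (m : ℂ) • LinearMap.id : SiteL2K ℂ d P c₀ W →ₗ[ℂ] SiteL2K ℂ d P c₀ W)) f⟫_ℂ := by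
  rw [LinearMap.add_apply, inner_add_right, map_add, covLaplaceSiteK, LinearMap.comp_apply,
    inner_covDivL2K_covDerivL2K (t : ℂ) (Complex.conj_ofReal t) R S hRS, LinearMap.smul_apply, LinearMap.id_apply, inner_smul_right]
  have h2 : RCLike.re ((m : ℂ) * ⟪f, f⟫_ℂ) = m * ‖f‖ ^ 2 := by
    rw [RCLike.re_to_complex, Complex.re_ofReal_mul, ← RCLike.re_to_complex, inner_self_eq_norm_sq (𝕜 := ℂ)]
  rw [h2, ← RCLike.ofReal_pow, RCLike.ofReal_re]
  have hf' : 0 < ‖f‖ := norm_pos_iff.mpr hf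
  nlinarith [sq_nonneg ‖covDerivL2K ℂ c₀ (t : ℂ) R f‖, mul_pos hm (pow_pos hf' 2)]

/-! ## §2 The weighted covariant VALUE row (Kato domination by the flat scalar resolvent of the weight) -/

/-- **THE `cosh`-WEIGHTED VALUE ROW OF THE COVARIANT MASSIVE RESOLVENT**: transporter data with `S(b)R(b) = 1` and `‖R(b)w‖, ‖S(b)w‖ ≤ ‖w‖`, real `t`, `m > 0`,
the window `2d·t²(cosh a − 1) < m`; if `Δ_{RS}u + m u = g` in `SiteL2K` and `‖g(y)‖ ≤ G_s·W_{x₀}(y)` (`G_s ≥ 0`) then at every site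
`‖u(x)‖ ≤ (m − 2d·t²(cosh a − 1))⁻¹·G_s·W_{x₀}(x)`.  Proof: the flat scalar resolvent `φ` of `G_s·W_{x₀}` dominates `‖u‖`
(`B9Eq323KatoDomination.norm_le_scalar_of_covLaplaceSiteK_resolvent`) and `φ ≤ G_sλ⁻¹W_{x₀}` because `λW_{x₀} ≤ (L₀+m)W_{x₀}` (`B9Eq342CoshWeightSite.weight_site_supersolution`,
`B9Eq342SupNormBootstrap.scalar_le_mul_of_supersolution`). [folklore] [cite: Balaban1985BackgroundPropagators, (3.23) p.394, Thm 3.1 (3.42) p.397; Balaban1984PropagatorsI, p.36] -/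
theorem norm_apply_le_weighted_of_resolvent [∀ i, NeZero (P i)] (t : ℝ) (R S : Bond d P → W →ₗ[ℂ] W) (hSR : ∀ b w, S b (R b w) = w) (hRn : ∀ b w, ‖R b w‖ ≤ ‖w‖)
    (hSn : ∀ b w, ‖S b w‖ ≤ ‖w‖) {m a : ℝ} (hm : 0 < m) (hlam : 2 * (d : ℝ) * t ^ 2 * (Real.cosh a - 1) < m) {u g : SiteL2K ℂ d P c₀ W}
    (hug : covLaplaceSiteK (t : ℂ) R S u + (m : ℂ) • u = g) (x₀ : TSite d P) {Gs : ℝ} (hGs : 0 ≤ Gs)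
    (hg : ∀ y, ‖WL2.equiv ℂ _ W g y‖ ≤ Gs * ∏ μ, Real.cosh (a * (circAbs (P μ) ((((x₀ μ : ℕ) : ZMod (P μ)) - ((y μ : ℕ) : ZMod (P μ))).val) : ℝ)))
    (x : TSite d P) :
    ‖WL2.equiv ℂ _ W u x‖ ≤ (m - 2 * (d : ℝ) * t ^ 2 * (Real.cosh a - 1))⁻¹ * Gs *
      ∏ μ, Real.cosh (a * (circAbs (P μ) ((((x₀ μ : ℕ) : ZMod (P μ)) - ((x μ : ℕ) : ZMod (P μ))).val) : ℝ)) := by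
  set lam : ℝ := m - 2 * (d : ℝ) * t ^ 2 * (Real.cosh a - 1) with hlamdef
  have hlam0 : 0 < lam := by rw [hlamdef]; linarith
  set Wt : TSite d P → ℝ := fun y => ∏ μ, Real.cosh (a * (circAbs (P μ) ((((x₀ μ : ℕ) : ZMod (P μ)) - ((y μ : ℕ) : ZMod (P μ))).val) : ℝ)) with hWt
  -- the flat scalar resolvent of `G_s·W` in the `Sum.elim unshift shift` graph form
  let nbr : TSite d P → Fin d ⊕ Fin d → TSite d P := fun y j => Sum.elim (fun μ => unshift μ y) (fun μ => shift μ y) j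
  obtain ⟨φ, hφ⟩ := exists_scalar_resolvent nbr (fun _ _ => t ^ 2) (fun _ _ => sq_nonneg t) hm fun y => Gs * Wt y
  -- the weighted maximum principle: `φ ≤ G_s λ⁻¹ W`
  have hsup : ∀ y, lam * Wt y ≤ ∑ j, t ^ 2 * (Wt y - Wt (nbr y j)) + m * Wt y := fun y => by
    have h := weight_site_supersolution P a t m x₀ y
    exact h
  have hφle : ∀ y, φ y ≤ Gs * lam⁻¹ * Wt y :=
    scalar_le_mul_of_supersolution nbr (fun _ _ => t ^ 2) (fun _ _ => sq_nonneg t) hm (s := Gs * lam⁻¹) (by positivity) hsup hφ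
      (fun y => le_of_eq (by field_simp))
  -- the Fin-`d` form of the scalar equation
  have hφ' : ∀ y, ∑ μ, t ^ 2 * ((φ y - φ (unshift μ y)) + (φ y - φ (shift μ y))) + m * φ y = Gs * Wt y := fun y => by
    rw [← hφ y, Fintype.sum_sum_type, ← Finset.sum_add_distrib]
    congr 1
    refine Finset.sum_congr rfl fun μ _ => ?_
    simp only [nbr, Sum.elim_inl, Sum.elim_inr]
    ring
  -- domination
  have hdom := norm_le_scalar_of_covLaplaceSiteK_resolvent (𝕜 := ℂ) t R S hSR hRn hSn hm hug hφ' hg x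
  calc ‖WL2.equiv ℂ _ W u x‖ ≤ φ x := hdom
    _ ≤ Gs * lam⁻¹ * Wt x := hφle x
    _ = lam⁻¹ * Gs * Wt x := by ring

/-! ## §3 The flat weighted ADJOINT row, read in the chain's `SiteL2K ℂ` currency -/

/-- **THE FLAT WEIGHTED ADJOINT ROW IN `SiteL2K ℂ`**: in the window (`t > 0`, `a ≥ 0`, `2d·t²(cosh a − 1) < m`, `P_ν ≥ 2`), every solution of
`Δ_1u + m u = D*_1f` (`R = S = 1`: `covLaplaceSiteK (t:ℂ) 1 1`, `covDivL2K c₀ (t:ℂ) 1`) with `‖f(b)‖ ≤ F·W_{x₀}(b₋)` obeys `‖u(x)‖ ≤ t·(Σ_νB_ν)·F·W_{x₀}(x)` —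
`B5Eq129FreeResolventWeightedAdjointRow.norm_apply_le_of_resolvent_covDiv_weighted` after unfolding the chain's operators pointwise
(`equiv_covLaplaceSiteK_eq_sum`, `equiv_covDivL2K`, `covDiv_apply`) and bridging complex∕real scalars (`Complex.coe_smul`). [folklore]
[cite: Balaban1985BackgroundPropagators, (3.23) p.394, (3.8) p.392, Thm 3.1 (3.42) p.397; Balaban1984PropagatorsI, (1.29) p.23, p.36] -/
theorem norm_apply_le_weighted_of_flat_resolvent_covDiv [∀ i, NeZero (P i)] (t : ℝ) (ht : 0 < t) {m a : ℝ} (hm : 0 < m) (ha : 0 ≤ a)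
    (hlam : 2 * (d : ℝ) * t ^ 2 * (Real.cosh a - 1) < m) (hn : ∀ ν, 2 ≤ P ν) {u : SiteL2K ℂ d P c₀ W} {f : BondL2K ℂ d P c₀ W}
    (hu : covLaplaceSiteK (t : ℂ) (fun _ : Bond d P => (LinearMap.id : W →ₗ[ℂ] W)) (fun _ => LinearMap.id) u + (m : ℂ) • u =
      covDivL2K ℂ c₀ (t : ℂ) (fun _ : Bond d P => (LinearMap.id : W →ₗ[ℂ] W)) f)
    (x₀ : TSite d P) {F : ℝ}
    (hf : ∀ b : Bond d P, ‖WL2.equiv ℂ _ W f b‖ ≤ F * ∏ μ, Real.cosh (a * (circAbs (P μ) ((((x₀ μ : ℕ) : ZMod (P μ)) - ((bpos b μ : ℕ) : ZMod (P μ))).val) : ℝ)))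
    (x : TSite d P) :
    ‖WL2.equiv ℂ _ W u x‖ ≤ t * (∑ ν : Fin d, ((1 + Real.exp (-a)) * ((1 + 2 * t / (P ν * Real.sqrt (m - 2 * ((d : ℝ) - 1) * t ^ 2 * (Real.cosh a - 1)))) /
            Real.sqrt ((m - 2 * ((d : ℝ) - 1) * t ^ 2 * (Real.cosh a - 1)) ^ 2 + 4 * (m - 2 * ((d : ℝ) - 1) * t ^ 2 * (Real.cosh a - 1)) * t ^ 2)) +
          2 * Real.sinh a / (m - 2 * (d : ℝ) * t ^ 2 * (Real.cosh a - 1)))) *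
        F * ∏ μ, Real.cosh (a * (circAbs (P μ) ((((x₀ μ : ℕ) : ZMod (P μ)) - ((x μ : ℕ) : ZMod (P μ))).val) : ℝ)) := by
  refine norm_apply_le_of_resolvent_covDiv_weighted P t ht hm ha hlam hn (u := WL2.equiv ℂ _ W u) (f := WL2.equiv ℂ _ W f) (fun y => ?_) x₀ hf x
  have e := congr_arg (fun g => WL2.equiv ℂ _ W g y) hu
  simp only [WL2.equiv_add, WL2.equiv_smul, Pi.add_apply, Pi.smul_apply] at e
  have hs := equiv_covLaplaceSiteK_eq_sum (𝕜 := ℂ) (c₀ := c₀) t (fun _ : Bond d P => (LinearMap.id : W →ₗ[ℂ] W)) (fun _ => LinearMap.id)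
    (fun b w => rfl) u y
  rw [RCLike.ofReal_eq_complex_ofReal] at hs
  rw [hs, equiv_covDivL2K, covDiv_apply] at e
  simp only [LinearMap.id_coe, id_eq, Complex.coe_smul] at e
  exact e

/-! ## §4 The split letters: `D*_S − D*_1` and `(Δ_{RS} − Δ_1)z = D*_Sq + s` -/

section Split

variable (t : ℝ) (R S : Bond d P → W →ₗ[ℂ] W)

/-- **`D*_Sf − D*_1f` POINTWISE**: `(D*_Sf)(y) − (D*_1f)(y) = t•Σ_μ(S(y−e_μ,μ) − 1)f(y−e_μ,μ)` ((3.8) with `S` against (3.8) with `1`). [folklore]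
[cite: Balaban1985BackgroundPropagators, (3.8) p.392] -/
theorem covDiv_sub_covDiv_flat_apply (f : Bond d P → W) (y : TSite d P) :
    covDiv (t : ℂ) S f y - covDiv (t : ℂ) (fun _ : Bond d P => (LinearMap.id : W →ₗ[ℂ] W)) f y =
      (t : ℂ) • ∑ μ, (S (unshift μ y, μ) (f (unshift μ y, μ)) - f (unshift μ y, μ)) := by
  rw [covDiv_apply, covDiv_apply, ← smul_sub, ← Finset.sum_sub_distrib]
  congr 1
  refine Finset.sum_congr rfl fun μ _ => ?_
  simp only [LinearMap.id_coe, id_eq]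
  abel

/-- **`‖(D*_Sf − D*_1f)(y)‖ ≤ |t|·ε·Σ_μ‖f(y−e_μ,μ)‖`** when `‖S(b)w − w‖ ≤ ε‖w‖`. [folklore] [cite: Balaban1985BackgroundPropagators, (3.8) p.392, (3.35) p.396] -/
theorem norm_covDiv_sub_covDiv_flat_apply_le {ε : ℝ} (hSε : ∀ b w, ‖S b w - w‖ ≤ ε * ‖w‖) (f : Bond d P → W) (y : TSite d P) :
    ‖covDiv (t : ℂ) S f y - covDiv (t : ℂ) (fun _ : Bond d P => (LinearMap.id : W →ₗ[ℂ] W)) f y‖ ≤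
      |t| * (ε * ∑ μ, ‖f (unshift μ y, μ)‖) := by
  rw [covDiv_sub_covDiv_flat_apply, norm_smul, Complex.norm_real, Real.norm_eq_abs, Finset.mul_sum]
  exact mul_le_mul_of_nonneg_left ((norm_sum_le _ _).trans (Finset.sum_le_sum fun μ _ => hSε _ _)) (abs_nonneg t)

/-- **THE DIVERGENCE-FORM SPLIT OF THE FIRST-ORDER PERTURBATION** (`S(b)R(b) = 1`): for every site field `z`,
`(Δ_{RS}z)(x) − (Δ_1z)(x) = (D*_Sq)(x) + s(x)` with the bond field `q(x,μ) = t•((R(x,μ)z(x+e_μ) − z(x+e_μ)) − (S(x,μ)z(x) − z(x)))` and the site field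
`s(x) = t²•Σ_μ((S(x−e_μ,μ)((S(x−e_μ,μ) − 1)z(x−e_μ)) − (S(x−e_μ,μ) − 1)z(x−e_μ)) + (S(x−e_μ,μ)z(x) − S(x,μ)z(x)))` — the `z(x)`-terms cancel by `SR = 1`, the
`z(x+e_μ)`-terms are `−t²(R − 1)z(x+e_μ)`, the `z(x−e_μ)`-terms `−t²(S − 1)z(x−e_μ)` (both Laplacians in their Kato form `equiv_covLaplaceSiteK_eq_sum`).
[folklore] [cite: Balaban1985BackgroundPropagators, (3.23) p.394, (3.3) p.391, (3.8) p.392] -/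
theorem covLaplace_sub_flat_eq_covDiv_add (hSR : ∀ b w, S b (R b w) = w) (z : SiteL2K ℂ d P c₀ W) (x : TSite d P) :
    WL2.equiv ℂ _ W (covLaplaceSiteK (t : ℂ) R S z) x -
        WL2.equiv ℂ _ W (covLaplaceSiteK (t : ℂ) (fun _ : Bond d P => (LinearMap.id : W →ₗ[ℂ] W)) (fun _ => LinearMap.id) z) x =
      covDiv (t : ℂ) S (fun b : Bond d P => (t : ℂ) • ((R b (WL2.equiv ℂ _ W z (btgt b)) - WL2.equiv ℂ _ W z (btgt b)) -
          (S b (WL2.equiv ℂ _ W z (bpos b)) - WL2.equiv ℂ _ W z (bpos b)))) x +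
        ((t ^ 2 : ℝ) : ℂ) • ∑ μ, ((S (unshift μ x, μ) (S (unshift μ x, μ) (WL2.equiv ℂ _ W z (unshift μ x)) - WL2.equiv ℂ _ W z (unshift μ x)) -
            (S (unshift μ x, μ) (WL2.equiv ℂ _ W z (unshift μ x)) - WL2.equiv ℂ _ W z (unshift μ x))) +
          (S (unshift μ x, μ) (WL2.equiv ℂ _ W z x) - S (x, μ) (WL2.equiv ℂ _ W z x))) := by
  have h1 := equiv_covLaplaceSiteK_eq_sum (𝕜 := ℂ) t R S hSR z x
  have h2 := equiv_covLaplaceSiteK_eq_sum (𝕜 := ℂ) t (fun _ : Bond d P => (LinearMap.id : W →ₗ[ℂ] W)) (fun _ => LinearMap.id) (fun b w => rfl) z x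
  rw [RCLike.ofReal_eq_complex_ofReal] at h1 h2
  set v := WL2.equiv ℂ _ W z with hv
  rw [h1, h2, covDiv_apply, ← Finset.sum_sub_distrib, Finset.smul_sum, Finset.smul_sum, ← Finset.sum_add_distrib]
  refine Finset.sum_congr rfl fun μ _ => ?_
  simp only [LinearMap.id_coe, id_eq, bpos, btgt, shift_unshift, map_sub, map_smul, hSR, smul_sub, smul_add, smul_smul, sq, Complex.ofReal_mul]
  -- fibre algebra: both sides are ℂ-linear combinations of `v x`, `v (shift μ x)`, `v (unshift μ x)` and transported values
  abel

/-- **SIZE OF `q`**: `‖q(b)‖ ≤ |t|·ε·(‖z(b₊)‖ + ‖z(b₋)‖)` from `‖R(b)w − w‖, ‖S(b)w − w‖ ≤ ε‖w‖`. [folklore] [cite: Balaban1985BackgroundPropagators, (3.35) p.396, (3.3) p.391] -/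
theorem norm_q_apply_le {ε : ℝ} (hRε : ∀ b w, ‖R b w - w‖ ≤ ε * ‖w‖) (hSε : ∀ b w, ‖S b w - w‖ ≤ ε * ‖w‖) (v : TSite d P → W) (b : Bond d P) :
    ‖(t : ℂ) • ((R b (v (btgt b)) - v (btgt b)) - (S b (v (bpos b)) - v (bpos b)))‖ ≤ |t| * (ε * (‖v (btgt b)‖ + ‖v (bpos b)‖)) := by
  rw [norm_smul, Complex.norm_real, Real.norm_eq_abs, mul_add]
  exact mul_le_mul_of_nonneg_left ((norm_sub_le _ _).trans (add_le_add (hRε _ _) (hSε _ _))) (abs_nonneg t)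

/-- **SIZE OF `s`**: `‖s(x)‖ ≤ t²·Σ_μ(ε²‖z(x−e_μ)‖ + ε′‖z(x)‖)` from `‖S(b)w − w‖ ≤ ε‖w‖` (used twice: `(S − 1)∘(S − 1)`) and `‖S(x,μ)w − S(x−e_μ,μ)w‖ ≤ ε′‖w‖`.
[folklore] [cite: Balaban1985BackgroundPropagators, (3.35) p.396, (3.8) p.392] -/
theorem norm_s_apply_le {ε ε' : ℝ} (hSε : ∀ b w, ‖S b w - w‖ ≤ ε * ‖w‖)
    (hSε' : ∀ (x : TSite d P) (μ : Fin d) (w : W), ‖S (x, μ) w - S (unshift μ x, μ) w‖ ≤ ε' * ‖w‖) (hε : 0 ≤ ε) (v : TSite d P → W) (x : TSite d P) :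
    ‖((t ^ 2 : ℝ) : ℂ) • ∑ μ, ((S (unshift μ x, μ) (S (unshift μ x, μ) (v (unshift μ x)) - v (unshift μ x)) -
            (S (unshift μ x, μ) (v (unshift μ x)) - v (unshift μ x))) +
          (S (unshift μ x, μ) (v x) - S (x, μ) (v x)))‖ ≤
      t ^ 2 * ∑ μ, (ε ^ 2 * ‖v (unshift μ x)‖ + ε' * ‖v x‖) := by
  rw [norm_smul, Complex.norm_real, Real.norm_eq_abs, abs_of_nonneg (sq_nonneg t)]
  refine mul_le_mul_of_nonneg_left ((norm_sum_le _ _).trans (Finset.sum_le_sum fun μ _ => (norm_add_le _ _).trans (add_le_add ?_ ?_))) (sq_nonneg t)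
  · -- `(S − 1)((S − 1)w)` with `w = v(x − e_μ)`
    have h1 : S (unshift μ x, μ) (S (unshift μ x, μ) (v (unshift μ x)) - v (unshift μ x)) - (S (unshift μ x, μ) (v (unshift μ x)) - v (unshift μ x)) =
        S (unshift μ x, μ) (S (unshift μ x, μ) (v (unshift μ x)) - v (unshift μ x)) - (S (unshift μ x, μ) (v (unshift μ x)) - v (unshift μ x)) := rfl
    calc ‖S (unshift μ x, μ) (S (unshift μ x, μ) (v (unshift μ x)) - v (unshift μ x)) - (S (unshift μ x, μ) (v (unshift μ x)) - v (unshift μ x))‖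
        ≤ ε * ‖S (unshift μ x, μ) (v (unshift μ x)) - v (unshift μ x)‖ := hSε _ _
      _ ≤ ε * (ε * ‖v (unshift μ x)‖) := mul_le_mul_of_nonneg_left (hSε _ _) hε
      _ = ε ^ 2 * ‖v (unshift μ x)‖ := by ring
  · rw [norm_sub_rev]
    exact hSε' x μ (v x)

end Split

end Literature.MathematicalPhysics.QuantumFieldTheory.Balaban1983to89.B9Eq342CovariantResolventAdjointRowLetters

end
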